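import Literature.Analysis.FluidPDE.RepresentedDerivatives
import Literature.Analysis.FluidPDE.WeakGradientSlicing
import HarnessLib

/-!
# Slicing space–time identities of spatial order at most two

Analysis/FluidPDE file (sequel to `RepresentedDerivatives` and `WeakGradientSlicing`). In a
regularity bootstrap for a distributional solution one repeatedly passes from a space–time weak
identity `∑ₘ ∫ hₘ ∂^{dsₘ}ψ = 0` (all space–time test functions `ψ` on `(a, b) × Ω`; e.g. the weak
Poisson equation `∫ U Δψ + ∑_c ∫ A_c ∂_cψ = 0` for a velocity component, or weak
incompressibility) to the *sliced* identities `∑ₘ ∫ hₘ(t, ·) ∂^{dsₘ}φ = 0` for a.e. `t`,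
**simultaneously for all** `φ ∈ C_c^∞(Ω)`, in order to apply elliptic estimates at fixed times
(Caffarelli–Kohn–Nirenberg 1982, §2; Robinson–Rodrigo–Sadowski 2016, Lemma 15.10; Serrin 1962).
The tree's `WeakGradientSlicing` does this for first-order identities (weak gradients); this file
proves the version for finitely many terms of spatial order `≤ 2` (`ae_slice_identity_sum`):

1. one test function `φ`: test with `η(t)φ(x)` and apply du Bois-Reymond in `t`
   (`ae_slice_identity_sum_single`);
2. countable `C²`-dense families of test functions supported in the members of a compact
   exhaustion of `Ω` (`exists_countable_testFunctions_dense₂`: separability of the space of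
   continuous scalar `2`-jets on a compact set), and dominated convergence at a good time.

Supporting material: purely spatial iterated derivatives `sderivs` (with
`derivs vs (η ⊗ φ) = η ⊗ sderivs vs φ`), expansions of (bi)linear forms along a basis, and uniform
convergence of finite linear combinations.

## References

* L. Caffarelli, R. Kohn, L. Nirenberg, Comm. Pure Appl. Math. 35 (1982), §2.
  [`CaffarelliKohnNirenberg1982`]
* J. C. Robinson, J. L. Rodrigo, W. Sadowski, *The Three-Dimensional Navier–Stokes Equations*
  (2016), Lemma 15.10. [`RobinsonRodrigoSadowski2016`]
* J. Serrin, Arch. Rational Mech. Anal. 9 (1962) 187–195. [folklore]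
-/

noncomputable section

open MeasureTheory Set Function Filter Topology TopologicalSpace Metric
open scoped NNReal ENNReal

namespace Literature.Analysis.FluidPDE

namespace RepDeriv

/-! ### Countably many test functions control all of them, with two derivatives -/

section Density

variable {X : Type*} [NormedAddCommGroup X] [NormedSpace ℝ X]

/-- **Countable `C²`-dense families of test functions with support in a fixed compact set.** For
an open set `Ω`, a compact `K` and a basis `b` there is a countable family `D` of test functions
on `Ω` supported in `K` such that every test function `ψ` on `Ω` supported in `K` is the uniform
limit of a sequence in `D` whose first and second partial derivatives along `b` converge
uniformly to those of `ψ` (separability of the metric space `C(K, ℝ × ℝ^ι × ℝ^{ι × ι})` of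
`2`-jets; the tree's `exists_countable_testFunctions_dense` is the `C¹` version). [folklore] -/
theorem exists_countable_testFunctions_dense₂ {ι : Type*} [Fintype ι] (b : Module.Basis ι ℝ X)
    (Ω : Opens X) {K : Set X} (hK : IsCompact K) :
    ∃ D : Set (X → ℝ), D.Countable ∧
      (∀ ψ ∈ D, FunctionSpaces.IsTestFunctionOn Ω ψ ∧ tsupport ψ ⊆ K) ∧
      ∀ ψ : X → ℝ, FunctionSpaces.IsTestFunctionOn Ω ψ → tsupport ψ ⊆ K →
        ∃ s : ℕ → X → ℝ, (∀ k, s k ∈ D) ∧ TendstoUniformly s ψ atTop ∧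
          (∀ i, TendstoUniformly (fun k x => fderiv ℝ (s k) x (b i))
            (fun x => fderiv ℝ ψ x (b i)) atTop) ∧
          ∀ i j, TendstoUniformly (fun k x => fderiv ℝ (fderiv ℝ (s k)) x (b i) (b j))
            (fun x => fderiv ℝ (fderiv ℝ ψ) x (b i) (b j)) atTop := by
  classical
  haveI : CompactSpace K := isCompact_iff_compactSpace.1 hK
  set T : Set (X → ℝ) := {ψ | FunctionSpaces.IsTestFunctionOn Ω ψ ∧ tsupport ψ ⊆ K} with hT
  -- the scalar `2`-jet of a function along the basis
  set J : (X → ℝ) → X → ℝ × (ι → ℝ) × (ι → ι → ℝ) := fun ψ x =>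
    (ψ x, fun i => fderiv ℝ ψ x (b i), fun i j => fderiv ℝ (fderiv ℝ ψ) x (b i) (b j)) with hJ
  have hJc : ∀ ψ ∈ T, Continuous (fun x : K => J ψ x) := by
    intro ψ hψ
    have h2 : ContDiff ℝ 2 ψ := hψ.1.contDiff.of_le (by norm_cast)
    have hD2 : Continuous (fderiv ℝ (fderiv ℝ ψ)) :=
      (h2.fderiv_right (m := 1) le_rfl).continuous_fderiv one_ne_zero
    have hc : Continuous (J ψ) := by
      refine hψ.1.contDiff.continuous.prodMk ((continuous_pi fun i => ?_).prodMk
        (continuous_pi fun i => continuous_pi fun j => ?_))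
      · exact (hψ.1.contDiff.continuous_fderiv (by simp)).clm_apply continuous_const
      · exact (hD2.clm_apply continuous_const).clm_apply continuous_const
    exact hc.comp continuous_subtype_val
  set S : Set C(K, ℝ × (ι → ℝ) × (ι → ι → ℝ)) :=
    {F | ∃ ψ ∈ T, ⇑F = fun x : K => J ψ x} with hS
  have hsel : ∀ F : S, ∃ ψ ∈ T, ⇑(F : C(K, ℝ × (ι → ℝ) × (ι → ι → ℝ))) = fun x : K => J ψ x :=
    fun F => F.2
  choose sel hselT hselF using hsel
  obtain ⟨d, hdc, hdd⟩ := TopologicalSpace.exists_countable_dense S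
  -- vanishing of the jets off `K` for members of `T`
  have hvan : ∀ ψ ∈ T, ∀ x ∉ K, ψ x = 0 ∧ fderiv ℝ ψ x = 0 ∧ fderiv ℝ (fderiv ℝ ψ) x = 0 := by
    intro ψ hψ x hx
    have hx' : x ∉ tsupport ψ := fun h' => hx (hψ.2 h')
    refine ⟨image_eq_zero_of_notMem_tsupport hx', fderiv_of_notMem_tsupport (𝕜 := ℝ) hx', ?_⟩
    exact fderiv_of_notMem_tsupport (𝕜 := ℝ) fun h' => hx' (tsupport_fderiv_subset ℝ h')
  have hvanJ : ∀ ψ ∈ T, ∀ x ∉ K, J ψ x = 0 := by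
    intro ψ hψ x hx
    obtain ⟨h0, h1, h2⟩ := hvan ψ hψ x hx
    simp only [hJ, h0, h1, h2, zero_apply]
    rfl
  refine ⟨sel '' d, hdc.image _, ?_, ?_⟩
  · rintro ψ ⟨F, -, rfl⟩
    exact hselT F
  · intro ψ hψ hψK
    have hψT : ψ ∈ T := ⟨hψ, hψK⟩
    set Fψ : C(K, ℝ × (ι → ℝ) × (ι → ι → ℝ)) := ⟨fun x : K => J ψ x, hJc ψ hψT⟩ with hFψ
    have hFψS : Fψ ∈ S := ⟨ψ, hψT, rfl⟩
    have hcl : (⟨Fψ, hFψS⟩ : S) ∈ closure d := by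
      rw [hdd.closure_eq]; exact mem_univ _
    obtain ⟨c, hcd, hclim⟩ := mem_closure_iff_seq_limit.1 hcl
    refine ⟨fun k => sel (c k), fun k => ⟨c k, hcd k, rfl⟩, ?_⟩
    have h1 : Tendsto (fun k => ((c k : S) : C(K, ℝ × (ι → ℝ) × (ι → ι → ℝ)))) atTop (𝓝 Fψ) :=
      (continuous_subtype_val.tendsto _).comp hclim
    have h4 : ∀ k (x : K), ((c k : S) : C(K, ℝ × (ι → ℝ) × (ι → ι → ℝ))) x = J (sel (c k)) x :=
      fun k x => congrFun (hselF (c k)) x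
    -- uniform convergence of the jets: on `K` from the convergence in `C(K, _)`, off `K` trivial
    have h2 : TendstoUniformly (fun k (x : K) => ((c k : S) : C(K, ℝ × (ι → ℝ) × (ι → ι → ℝ))) x)
        Fψ atTop :=
      ContinuousMap.tendsto_iff_tendstoUniformly.1 h1
    have h2' : @TendstoUniformly K (ℝ × (ι → ℝ) × (ι → ι → ℝ)) ℕ PseudoMetricSpace.toUniformSpace
        (fun k (x : K) => ((c k : S) : C(K, ℝ × (ι → ℝ) × (ι → ι → ℝ))) x) Fψ atTop := h2
    have h3 := Metric.tendstoUniformly_iff.1 h2'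
    have hJu : ∀ ε > 0, ∀ᶠ k in atTop, ∀ x, dist (J ψ x) (J (sel (c k)) x) < ε := by
      intro ε hε
      filter_upwards [h3 ε hε] with k hk x
      by_cases hx : x ∈ K
      · have h := hk ⟨x, hx⟩
        rw [h4 k ⟨x, hx⟩] at h
        exact h
      · rw [hvanJ ψ hψT x hx, hvanJ (sel (c k)) (hselT (c k)) x hx, dist_self]
        exact hε
    refine ⟨?_, fun i => ?_, fun i j => ?_⟩
    · refine Metric.tendstoUniformly_iff.2 fun ε hε => ?_
      filter_upwards [hJu ε hε] with k hk x
      refine lt_of_le_of_lt ?_ (hk x)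
      rw [Prod.dist_eq]
      exact le_max_left _ _
    · refine Metric.tendstoUniformly_iff.2 fun ε hε => ?_
      filter_upwards [hJu ε hε] with k hk x
      refine lt_of_le_of_lt ?_ (hk x)
      rw [Prod.dist_eq, Prod.dist_eq]
      exact ((dist_le_pi_dist (J ψ x).2.1 (J (sel (c k)) x).2.1 i).trans (le_max_left _ _)).trans
        (le_max_right _ _)
    · refine Metric.tendstoUniformly_iff.2 fun ε hε => ?_
      filter_upwards [hJu ε hε] with k hk x
      refine lt_of_le_of_lt ?_ (hk x)
      rw [Prod.dist_eq, Prod.dist_eq]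
      exact ((((dist_le_pi_dist ((J ψ x).2.2 i) ((J (sel (c k)) x).2.2 i) j).trans
        (dist_le_pi_dist (J ψ x).2.2 (J (sel (c k)) x).2.2 i)).trans (le_max_right _ _)).trans
        (le_max_right _ _))

end Density

/-! ### Uniform convergence of linear combinations -/

section Combinations

variable {α κ' : Type*}

/-- Constant multiples of a uniformly convergent real sequence converge uniformly. [folklore] -/
theorem tendstoUniformly_const_mul (c : ℝ) {F : ℕ → α → ℝ} {f : α → ℝ}
    (h : TendstoUniformly F f atTop) :
    TendstoUniformly (fun k x => c * F k x) (fun x => c * f x) atTop := by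
  refine Metric.tendstoUniformly_iff.2 fun ε hε => ?_
  have hδ : 0 < ε / (|c| + 1) := div_pos hε (by positivity)
  filter_upwards [Metric.tendstoUniformly_iff.1 h _ hδ] with k hk x
  have h1 := hk x
  rw [Real.dist_eq] at h1 ⊢
  calc |c * f x - c * F k x| = |c| * |f x - F k x| := by rw [← mul_sub, abs_mul]
    _ ≤ |c| * (ε / (|c| + 1)) := mul_le_mul_of_nonneg_left h1.le (abs_nonneg _)
    _ < ε := by
      rw [mul_div_assoc', div_lt_iff₀ (by positivity)]
      nlinarith [abs_nonneg c]

/-- Finite linear combinations with constant coefficients of uniformly convergent real sequences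
converge uniformly. [folklore] -/
theorem tendstoUniformly_finset_sum_mul (s : Finset κ') (c : κ' → ℝ)
    {F : κ' → ℕ → α → ℝ} {f : κ' → α → ℝ} (h : ∀ i ∈ s, TendstoUniformly (F i) (f i) atTop) :
    TendstoUniformly (fun k x => ∑ i ∈ s, c i * F i k x) (fun x => ∑ i ∈ s, c i * f i x) atTop := by
  classical
  induction s using Finset.induction_on with
  | empty =>
    refine Metric.tendstoUniformly_iff.2 fun ε hε => Eventually.of_forall fun k x => ?_
    simpa using hε
  | insert a s ha ih =>
    have h1 := tendstoUniformly_const_mul (c a) (h a (Finset.mem_insert_self a s))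
    have h2 := ih fun i hi => h i (Finset.mem_insert_of_mem hi)
    have e1 : (fun k x => ∑ i ∈ insert a s, c i * F i k x) =
        (fun k x => c a * F a k x) + fun k x => ∑ i ∈ s, c i * F i k x := by
      funext k x; simp [Finset.sum_insert ha]
    have e2 : (fun x => ∑ i ∈ insert a s, c i * f i x) =
        (fun x => c a * f a x) + fun x => ∑ i ∈ s, c i * f i x := by
      funext x; simp [Finset.sum_insert ha]
    rw [e1, e2]
    exact h1.add h2

end Combinations

/-! ### Purely spatial iterated derivatives -/

section SDerivs

variable {E : Type*} [NormedAddCommGroup E] [NormedSpace ℝ E]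
variable {F : Type*} [NormedAddCommGroup F] [NormedSpace ℝ F]

/-- **Iterated directional derivatives of a function of the space variable only**, head first:
`sderivs [] φ = φ`, `sderivs (v :: vs) φ = sderivs vs (∂ᵥφ)`. [folklore] -/
def sderivs : List E → (E → F) → (E → F)
  | [], φ => φ
  | v :: vs, φ => sderivs vs (fun x => fderiv ℝ φ x v)

/-- `sderivs [] φ = φ`. [folklore] -/
@[simp]
theorem sderivs_nil (φ : E → F) : sderivs ([] : List E) φ = φ := rfl

/-- `sderivs (v :: vs) φ = sderivs vs (∂ᵥφ)`. [folklore] -/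
@[simp]
theorem sderivs_cons (v : E) (vs : List E) (φ : E → F) :
    sderivs (v :: vs) φ = sderivs vs (fun x => fderiv ℝ φ x v) := rfl

/-- `derivs` of a time-independent field is the time-independent field of `sderivs`. [folklore] -/
theorem derivs_const_time (vs : List E) (φ : E → F) :
    derivs vs (fun _ : ℝ => φ) = fun _ => sderivs vs φ := by
  induction vs generalizing φ with
  | nil => rfl
  | cons v vs ih => exact ih _

/-- `sderivs` of a smooth function is smooth. [folklore] -/
theorem contDiff_sderivs (vs : List E) {φ : E → F} (hφ : ContDiff ℝ (⊤ : ℕ∞) φ) :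
    ContDiff ℝ (⊤ : ℕ∞) (sderivs vs φ) := by
  induction vs generalizing φ with
  | nil => exact hφ
  | cons v vs ih => exact ih ((hφ.fderiv_right (m := (⊤ : ℕ∞)) le_rfl).clm_apply contDiff_const)

/-- `sderivs` does not enlarge the topological support. [folklore] -/
theorem tsupport_sderivs_subset (vs : List E) (φ : E → F) : tsupport (sderivs vs φ) ⊆ tsupport φ := by
  induction vs generalizing φ with
  | nil => exact Subset.rfl
  | cons v vs ih => exact (ih _).trans (tsupport_fderiv_apply_subset ℝ v)

/-- `sderivs vs φ` vanishes off the topological support of `φ`. [folklore] -/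
theorem sderivs_eq_zero_of_notMem_tsupport (vs : List E) {φ : E → F} {x : E}
    (hx : x ∉ tsupport φ) : sderivs vs φ x = 0 :=
  image_eq_zero_of_notMem_tsupport fun h => hx (tsupport_sderivs_subset vs φ h)

/-- `sderivs` of a test function is a test function. [folklore] -/
theorem _root_.Literature.FunctionSpaces.IsTestFunctionOn.sderivs {Ω : Opens E} {φ : E → F}
    (hφ : FunctionSpaces.IsTestFunctionOn Ω φ) (vs : List E) :
    FunctionSpaces.IsTestFunctionOn Ω (sderivs vs φ) where
  contDiff := contDiff_sderivs vs hφ.contDiff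
  hasCompactSupport :=
    hφ.hasCompactSupport.of_isClosed_subset (isClosed_tsupport _) (tsupport_sderivs_subset vs φ)
  tsupport_subset := (tsupport_sderivs_subset vs φ).trans hφ.tsupport_subset

/-- **Separated variables**: `derivs vs (η ⊗ φ) = η ⊗ sderivs vs φ`. [folklore] -/
theorem derivs_time_mul (vs : List E) (η : ℝ → ℝ) {φ : E → ℝ} (hφ : ContDiff ℝ (⊤ : ℕ∞) φ) :
    derivs vs (fun t x => η t * φ x) = fun t x => η t * sderivs vs φ x := by
  induction vs generalizing φ with
  | nil => rfl
  | cons v vs ih =>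
    have hd : Differentiable ℝ φ := hφ.differentiable (by simp)
    have heq : (fun t x => fderiv ℝ (fun x => η t * φ x) x v) =
        fun t x => η t * fderiv ℝ φ x v := by
      funext t x
      rw [show (fun x => η t * φ x) = fun x => η t • φ x from rfl, fderiv_fun_const_smul (hd x)]
      rfl
    rw [derivs_cons, heq]
    exact ih ((hφ.fderiv_right (m := (⊤ : ℕ∞)) le_rfl).clm_apply contDiff_const)

/-- `sderivs [v, w] φ x = D²φ(x)(w)(v)` for a `C²` function. [folklore] -/
theorem sderivs_pair_eq {φ : E → F} (hφ : ContDiff ℝ (⊤ : ℕ∞) φ) (v w : E) :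
    sderivs [v, w] φ = fun x => fderiv ℝ (fderiv ℝ φ) x w v := by
  funext x
  simp only [sderivs_cons, sderivs_nil]
  have hd : DifferentiableAt ℝ (fderiv ℝ φ) x :=
    ((hφ.fderiv_right (m := (⊤ : ℕ∞)) le_rfl).differentiable (by simp)).differentiableAt
  rw [fderiv_clm_apply hd (differentiableAt_const v)]
  simp

/-- Expansion of a real continuous linear form along a basis: `L v = Σᵢ vᵢ L(bᵢ)`. [folklore] -/
theorem clm_apply_eq_sum_repr {ι : Type*} [Fintype ι] (b : Module.Basis ι ℝ E) (L : E →L[ℝ] ℝ)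
    (v : E) : L v = ∑ i, b.repr v i * L (b i) := by
  conv_lhs => rw [← b.sum_repr v]
  rw [map_sum]
  refine Finset.sum_congr rfl fun i _ => ?_
  rw [map_smul, smul_eq_mul]

/-- Expansion of a real continuous bilinear form along a basis:
`M w v = Σᵢ wᵢ Σⱼ vⱼ M(bᵢ)(bⱼ)`. [folklore] -/
theorem clm₂_apply_eq_sum_repr {ι : Type*} [Fintype ι] (b : Module.Basis ι ℝ E)
    (M : E →L[ℝ] E →L[ℝ] ℝ) (w v : E) :
    M w v = ∑ i, b.repr w i * ∑ j, b.repr v j * M (b i) (b j) := by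
  have h1 : M w = ∑ i, b.repr w i • M (b i) := by
    conv_lhs => rw [← b.sum_repr w]
    rw [map_sum]
    refine Finset.sum_congr rfl fun i _ => ?_
    rw [map_smul]
  rw [h1]
  simp only [FunLike.coe_sum, Finset.sum_apply, FunLike.coe_smul, Pi.smul_apply, smul_eq_mul]
  refine Finset.sum_congr rfl fun i _ => ?_
  rw [clm_apply_eq_sum_repr b (M (b i)) v]

/-- **Uniform `C²`-convergence along a basis passes to `sderivs` of length at most two.**
[folklore] -/
theorem tendstoUniformly_sderivs_of_length_le_two {ι : Type*} [Fintype ι] (b : Module.Basis ι ℝ E)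
    {s : ℕ → E → ℝ} {φ : E → ℝ}
    (hs : ∀ k, ContDiff ℝ (⊤ : ℕ∞) (s k)) (hφ : ContDiff ℝ (⊤ : ℕ∞) φ)
    (h0 : TendstoUniformly s φ atTop)
    (h1 : ∀ i, TendstoUniformly (fun k x => fderiv ℝ (s k) x (b i))
      (fun x => fderiv ℝ φ x (b i)) atTop)
    (h2 : ∀ i j, TendstoUniformly (fun k x => fderiv ℝ (fderiv ℝ (s k)) x (b i) (b j))
      (fun x => fderiv ℝ (fderiv ℝ φ) x (b i) (b j)) atTop)
    {vs : List E} (hvs : vs.length ≤ 2) :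
    TendstoUniformly (fun k => sderivs vs (s k)) (sderivs vs φ) atTop := by
  rcases vs with _ | ⟨v, _ | ⟨w, _ | ⟨z, rest⟩⟩⟩
  · exact h0
  · have key : ∀ f : E → ℝ, sderivs [v] f = fun x => ∑ i, b.repr v i * fderiv ℝ f x (b i) := by
      intro f; funext x
      exact clm_apply_eq_sum_repr b (fderiv ℝ f x) v
    rw [key φ, show (fun k => sderivs [v] (s k)) =
      fun k x => ∑ i, b.repr v i * fderiv ℝ (s k) x (b i) from funext fun k => key (s k)]
    exact tendstoUniformly_finset_sum_mul Finset.univ (fun i => b.repr v i) fun i _ => h1 i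
  · have key : ∀ f : E → ℝ, ContDiff ℝ (⊤ : ℕ∞) f → sderivs [v, w] f =
        fun x => ∑ i, b.repr w i * ∑ j, b.repr v j * fderiv ℝ (fderiv ℝ f) x (b i) (b j) := by
      intro f hf; funext x
      rw [sderivs_pair_eq hf]
      exact clm₂_apply_eq_sum_repr b (fderiv ℝ (fderiv ℝ f) x) w v
    rw [key φ hφ, show (fun k => sderivs [v, w] (s k)) = fun k x =>
      ∑ i, b.repr w i * ∑ j, b.repr v j * fderiv ℝ (fderiv ℝ (s k)) x (b i) (b j) from
        funext fun k => key (s k) (hs k)]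
    exact tendstoUniformly_finset_sum_mul Finset.univ (fun i => b.repr w i) fun i _ =>
      tendstoUniformly_finset_sum_mul Finset.univ (fun j => b.repr v j) fun j _ => h2 i j
  · simp at hvs

end SDerivs

/-! ### Slicing -/

section Slicing

variable {E : Type*} [NormedAddCommGroup E] [InnerProductSpace ℝ E] [FiniteDimensional ℝ E]
  [MeasurableSpace E] [BorelSpace E]

/-- For a compact time set `J ⊆ (a, b)`, a continuous `θ` on `E` vanishing off a compact
`K ⊆ Ω`, and `h` locally integrable on `(a, b) × Ω`, the integrand `(t, x) ↦ h(t, x) θ(x)` is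
integrable on `J × E`. [folklore] -/
theorem integrable_mul_prod_of_compact {a b : ℝ} {Ω : Opens E} {h : ℝ × E → ℝ}
    (hh : LocallyIntegrableOn h (Ioo a b ×ˢ (Ω : Set E)) volume) {θ : E → ℝ} (hθ : Continuous θ)
    {K : Set E} (hK : IsCompact K) (hKΩ : K ⊆ (Ω : Set E)) (hθK : ∀ x ∉ K, θ x = 0)
    {J : Set ℝ} (hJ : J ⊆ Ioo a b) (hJc : IsCompact J) :
    Integrable (fun z : ℝ × E => h z * θ z.2) ((volume.restrict J).prod (volume : Measure E)) := by
  have hC : IsCompact (J ×ˢ K) := hJc.prod hK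
  have hCQ : J ×ˢ K ⊆ Ioo a b ×ˢ (Ω : Set E) := prod_mono hJ hKΩ
  have huC : IntegrableOn h (J ×ˢ K) volume := hh.integrableOn_compact_subset hCQ hC
  have hθ' : Continuous fun z : ℝ × E => θ z.2 := hθ.comp continuous_snd
  have h1 : IntegrableOn (fun z : ℝ × E => h z * θ z.2) (J ×ˢ K) volume :=
    huC.mul_continuousOn hθ'.continuousOn hC
  have h2 : IntegrableOn (fun z : ℝ × E => h z * θ z.2) (J ×ˢ (univ : Set E)) volume := by
    refine h1.of_forall_sdiff_eq_zero (hJc.measurableSet.prod MeasurableSet.univ) ?_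
    rintro ⟨t, x⟩ ⟨htx, hz⟩
    have hx : x ∉ K := fun hx => hz ⟨(mem_prod.1 htx).1, hx⟩
    simp [hθK x hx]
  rw [Measure.restrict_prod_eq_prod_univ J, ← Measure.volume_eq_prod]
  exact h2

/-- **The slice identity for one test function.** If `∑ₘ ∫ hₘ · derivs (dsₘ) ψ = 0` for all
space–time test functions `ψ` on `(a, b) × Ω`, then for every `φ ∈ C_c^∞(Ω)`,
`∑ₘ ∫ hₘ(t, x) sderivs (dsₘ) φ (x) dx = 0` for a.e. `t ∈ (a, b)` (test with `η(t) φ(x)` and apply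
the fundamental lemma of the calculus of variations in `t`; Caffarelli–Kohn–Nirenberg 1982, §2).
[folklore] -/
theorem ae_slice_identity_sum_single {a b : ℝ} {Ω : Opens E} {κ : Type*} [Fintype κ]
    {h : κ → ℝ × E → ℝ} {ds : κ → List E}
    (hh : ∀ m, LocallyIntegrableOn (h m) (Ioo a b ×ˢ (Ω : Set E)) volume)
    (hid : ∀ ψ : ℝ → E → ℝ,
      IsSpaceTimeTestOn (⟨Ioo a b ×ˢ (Ω : Set E), isOpen_Ioo.prod Ω.isOpen⟩ : Opens (ℝ × E)) ψ →
        ∑ m, ∫ q : ℝ × E, h m q * derivs (ds m) ψ q.1 q.2 = 0)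
    {φ : E → ℝ} (hφ : FunctionSpaces.IsTestFunctionOn Ω φ) :
    ∀ᵐ t ∂(volume.restrict (Ioo a b)), ∑ m, ∫ x, h m (t, x) * sderivs (ds m) φ x = 0 := by
  classical
  set A : κ → ℝ → ℝ := fun m t => ∫ x, h m (t, x) * sderivs (ds m) φ x with hA
  have hθc : ∀ m, Continuous (sderivs (ds m) φ) := fun m =>
    (contDiff_sderivs (ds m) hφ.contDiff).continuous
  have hθK : ∀ m, ∀ x ∉ tsupport φ, sderivs (ds m) φ x = 0 := fun m x hx =>
    sderivs_eq_zero_of_notMem_tsupport (ds m) hx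
  -- local integrability of the slice pairings on `(a, b)`
  have hlocS : LocallyIntegrableOn (fun t => ∑ m, A m t) (Ioo a b) volume := by
    refine (locallyIntegrableOn_iff isOpen_Ioo.isLocallyClosed).2 fun J hJ hJc => ?_
    exact integrable_finsetSum Finset.univ fun m _ =>
      (integrable_mul_prod_of_compact (hh m) (hθc m) hφ.hasCompactSupport hφ.tsupport_subset
        (hθK m) hJ hJc).integral_prod_left
  -- the fundamental lemma of the calculus of variations in `t`
  have hkey : ∀ᵐ t ∂(volume : Measure ℝ), t ∈ Ioo a b → (fun t => ∑ m, A m t) t = 0 := by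
    refine isOpen_Ioo.ae_eq_zero_of_integral_contDiff_smul_eq_zero hlocS ?_
    intro η hη hηc hηs
    have hψ : IsSpaceTimeTestOn (⟨Ioo a b ×ˢ (Ω : Set E), isOpen_Ioo.prod Ω.isOpen⟩ : Opens (ℝ × E))
        (fun t x => η t * φ x) :=
      isSpaceTimeTestOn_mul hη hηc hηs hφ
    have h0 := hid _ hψ
    -- each space–time pairing is `∫ η Aₘ`
    have hterm : ∀ m, ∫ q : ℝ × E, h m q * derivs (ds m) (fun t x => η t * φ x) q.1 q.2 =
        ∫ t, η t * A m t := by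
      intro m
      rw [derivs_time_mul (ds m) η hφ.contDiff]
      have hint : Integrable (fun q : ℝ × E => h m q * (η q.1 * sderivs (ds m) φ q.2))
          ((volume : Measure ℝ).prod (volume : Measure E)) := by
        have := (isRepDeriv_nil (hh m)).integrable_mul' (hψ.derivs (ds m))
        rw [derivs_time_mul (ds m) η hφ.contDiff, Measure.volume_eq_prod] at this
        exact this
      rw [Measure.volume_eq_prod, integral_prod _ hint]
      refine integral_congr_ae (Eventually.of_forall fun t => ?_)
      simp only [hA]
      rw [← integral_const_mul]
      congr 1
      funext x
      ring
    -- integrability of `η Aₘ` on `ℝ`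
    have hηA : ∀ m, Integrable (fun t => η t * A m t) (volume : Measure ℝ) := by
      intro m
      have hint : Integrable (fun q : ℝ × E => h m q * (η q.1 * sderivs (ds m) φ q.2))
          ((volume : Measure ℝ).prod (volume : Measure E)) := by
        have := (isRepDeriv_nil (hh m)).integrable_mul' (hψ.derivs (ds m))
        rw [derivs_time_mul (ds m) η hφ.contDiff, Measure.volume_eq_prod] at this
        exact this
      have h1 := hint.integral_prod_left
      refine h1.congr (Eventually.of_forall fun t => ?_)
      simp only [hA]
      rw [← integral_const_mul]
      congr 1
      funext x
      ring
    have hsum : ∫ t, η t • (fun t => ∑ m, A m t) t = ∑ m, ∫ t, η t * A m t := by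
      rw [← integral_finsetSum _ fun m _ => hηA m]
      congr 1
      funext t
      simp only [smul_eq_mul, Finset.mul_sum]
    rw [hsum]
    simp_rw [← hterm]
    exact h0
  rw [ae_restrict_iff' measurableSet_Ioo]
  filter_upwards [hkey] with t ht htI
  exact ht htI

/-- **Slicing space–time identities of spatial order at most two.** Let `hₘ` (`m` in a finite
index set) be locally integrable on `(a, b) × Ω` and `dsₘ` lists of at most two directions with
`∑ₘ ∫ hₘ · derivs (dsₘ) ψ = 0` for every space–time test function `ψ` on `(a, b) × Ω` (e.g. a
weak Poisson equation `∫ U Δψ + ∑ ∫ A_c ∂_c ψ = 0`, or a weak divergence/curl identity). Then for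
a.e. `t ∈ (a, b)` the sliced identity `∑ₘ ∫ hₘ(t, x) sderivs (dsₘ) φ (x) dx = 0` holds
**simultaneously for all** `φ ∈ C_c^∞(Ω)` (countable `C²`-dense families on a compact
exhaustion, dominated convergence; Caffarelli–Kohn–Nirenberg 1982, §2; Robinson–Rodrigo–Sadowski
2016, Lemma 15.10). [folklore] -/
theorem ae_slice_identity_sum {a b : ℝ} {Ω : Opens E} {κ : Type*} [Fintype κ]
    {h : κ → ℝ × E → ℝ} {ds : κ → List E}
    (hh : ∀ m, LocallyIntegrableOn (h m) (Ioo a b ×ˢ (Ω : Set E)) volume)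
    (hds : ∀ m, (ds m).length ≤ 2)
    (hid : ∀ ψ : ℝ → E → ℝ,
      IsSpaceTimeTestOn (⟨Ioo a b ×ˢ (Ω : Set E), isOpen_Ioo.prod Ω.isOpen⟩ : Opens (ℝ × E)) ψ →
        ∑ m, ∫ q : ℝ × E, h m q * derivs (ds m) ψ q.1 q.2 = 0) :
    ∀ᵐ t ∂(volume.restrict (Ioo a b)), ∀ φ : E → ℝ, FunctionSpaces.IsTestFunctionOn Ω φ →
      ∑ m, ∫ x, h m (t, x) * sderivs (ds m) φ x = 0 := by
  classical
  -- exhaustions of `Ω` and of `(a, b)`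
  obtain ⟨K, hKc, hKΩ, hKabs⟩ := exists_compact_exhaustion_absorbing Ω
  set J : ℕ → Set ℝ := fun n => Icc (a + 1 / ((n : ℝ) + 1)) (b - 1 / ((n : ℝ) + 1)) with hJ
  have hJsub : ∀ n, J n ⊆ Ioo a b := by
    intro n t ht
    have hpos : (0 : ℝ) < 1 / ((n : ℝ) + 1) := Nat.one_div_pos_of_nat
    exact ⟨lt_of_lt_of_le (by linarith) ht.1, lt_of_le_of_lt ht.2 (by linarith)⟩
  have hJU : (⋃ n, J n) = Ioo a b := by
    refine subset_antisymm (iUnion_subset hJsub) fun t ht => ?_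
    obtain ⟨n, hn⟩ := exists_nat_one_div_lt (lt_min (sub_pos.2 ht.1) (sub_pos.2 ht.2))
    have h1 := min_le_left (t - a) (b - t)
    have h2 := min_le_right (t - a) (b - t)
    exact mem_iUnion.2 ⟨n, ⟨by linarith, by linarith⟩⟩
  -- (1) integrability of the slices on the `Kₙ`
  have hint : ∀ᵐ t ∂(volume.restrict (Ioo a b)), ∀ n m,
      IntegrableOn (fun x => h m (t, x)) (K n) volume := by
    rw [← hJU, ae_restrict_iUnion_iff]
    intro l
    refine ae_all_iff.2 fun n => ae_all_iff.2 fun m => ?_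
    have hC : IsCompact (J l ×ˢ K n) := isCompact_Icc.prod (hKc n)
    have hCQ : J l ×ˢ K n ⊆ Ioo a b ×ˢ (Ω : Set E) := prod_mono (hJsub l) (hKΩ n)
    have hu := (hh m).integrableOn_compact_subset hCQ hC
    rw [IntegrableOn, Measure.volume_eq_prod, ← Measure.prod_restrict] at hu
    filter_upwards [hu.prod_right_ae] with t htu
    exact htu
  -- (2) countable `C²`-dense families of test functions supported in the `Kₙ`
  have hD := fun n => exists_countable_testFunctions_dense₂ (Module.finBasis ℝ E) Ω (hKc n)
  choose D hDc hDT hDd using hD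
  have hidD : ∀ᵐ t ∂(volume.restrict (Ioo a b)), ∀ n, ∀ s ∈ D n,
      ∑ m, ∫ x, h m (t, x) * sderivs (ds m) s x = 0 := by
    refine ae_all_iff.2 fun n => (ae_ball_iff (hDc n)).2 fun s hs => ?_
    exact ae_slice_identity_sum_single hh hid (hDT n s hs).1
  filter_upwards [hint, hidD] with t hint hid
  intro φ hφ
  -- (3) density: approximate `φ` in `C²` by members of `D n`
  obtain ⟨n, hn⟩ := hKabs (tsupport φ) hφ.tsupport_subset hφ.hasCompactSupport
  obtain ⟨s, hsD, hs0, hs1, hs2⟩ := hDd n φ hφ hn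
  have hsT : ∀ k, FunctionSpaces.IsTestFunctionOn Ω (s k) ∧ tsupport (s k) ⊆ K n :=
    fun k => hDT n (s k) (hsD k)
  have hL : ∀ m, Tendsto (fun k => ∫ x, h m (t, x) * sderivs (ds m) (s k) x) atTop
      (𝓝 (∫ x, h m (t, x) * sderivs (ds m) φ x)) := by
    intro m
    have h1 := tendsto_integral_mul_of_tendstoUniformly (hKc n) (hint n m)
      (c := fun k => sderivs (ds m) (s k)) (c' := sderivs (ds m) φ)
      (fun k => (contDiff_sderivs (ds m) (hsT k).1.contDiff).continuous)
      (contDiff_sderivs (ds m) hφ.contDiff).continuous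
      (fun k x hx => sderivs_eq_zero_of_notMem_tsupport (ds m) fun h' => hx ((hsT k).2 h'))
      (tendstoUniformly_sderivs_of_length_le_two (Module.finBasis ℝ E)
        (fun k => (hsT k).1.contDiff) hφ.contDiff hs0 hs1 hs2 (hds m))
    simp_rw [mul_comm (sderivs (ds m) _ _)] at h1
    exact h1
  have hsum : Tendsto (fun k => ∑ m, ∫ x, h m (t, x) * sderivs (ds m) (s k) x) atTop
      (𝓝 (∑ m, ∫ x, h m (t, x) * sderivs (ds m) φ x)) :=
    tendsto_finsetSum Finset.univ fun m _ => hL m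
  have hzero : ∀ k, ∑ m, ∫ x, h m (t, x) * sderivs (ds m) (s k) x = 0 :=
    fun k => hid n (s k) (hsD k)
  exact tendsto_nhds_unique (hsum.congr hzero) tendsto_const_nhds

end Slicing

end RepDeriv

end Literature.Analysis.FluidPDE

end
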